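import Summits.CriticalPhenomena.PercolationContinuityZ3.Theorems.PercNearOneGluingNoHeavyLowerTailUpsetExchangeUnion
import HarnessLib

/-!
# `NoHeavyLowerTail` (stmt-CriticalPhenomena-4575) — the THREE-RELAY EXCHANGE: a weak relay `v`, a (glued) strong
# relay `q`, and a spectator `a`

Support file (lemma factory `prim-lf-3` gen 6, seat g7; `--supports stmt-CriticalPhenomena-4575`).  No definitions, no
named facts, no sorries.  Memo: `run/shared/lean/prim/prim-lf-3/LF3-Q9LP.md` §7 (inequality (♠)).

Setting (`Fin n`, ranking weights `w`, block `C` glued: `glue_C w` = weight `1` on every non-loop pair inside `C`).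
If `μ_w(v ↔ b) ≤ μ_w(q ↔ b)` for a member `q ∈ C`, then for EVERY vertex `a`:

  `μ_{glue_C w}(v ↔ b, q ↮ b, a ↔ q) ≤ μ_{glue_C w}(q ↔ b, v ↮ b, a ↮ v)`      (`threeRelayExchange`)

("if the weak relay reaches `b`, the strong block does not, and the spectator sits in the block's cluster" is less likely
than "the strong block reaches `b`, the weak relay does not, and the spectator is off the weak relay's cluster").
Proof: `UpsetExchange.upsetExchange_event` with the event `E = {q ↔ a}` (increasing in the open edge cluster of `q`, and
`E ∩ {C internally open}` stays so) gives `μ_g(v ↔ b, q ↔ a) ≤ μ_g(q ↔ b, q ↔ a)`; remove the common part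
`{v ↔ b, q ↔ b, q ↔ a}` from both sides and note `{q ↔ b, q ↔ a, v ↮ b} ⊆ {q ↔ b, v ↮ b, a ↮ v}`.
This is the exchange step of the "Theorem 4 with one free port" inequality of the memo (§7):
`μ_G(x ↔ b) − μ_G(a ↔ b, x ↔ A) ≥ w(x,v)·(μ_G(v ↔ b) − μ_G(a ↔ b))` for a one-layer `x` whose other ports dominate `a` and
`v` off `x` — a two-sided, hypothesis-free form of Kozma–Nitzan's Theorem 4 (paper proof in the memo; 0 / 14 272 exact checks).
-/

namespace Summit.CriticalPhenomena.PercolationContinuityZ3.Theorems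

open MeasureTheory Set ProbabilityTheory
open Literature.Probability.LatticeModels
open Literature.Probability.Percolation

noncomputable section
open Classical

namespace UpsetExchange

variable {n : ℕ}

/-- **Three-relay exchange.**  `q ∈ C`, `μ_w(v ↔ b) ≤ μ_w(q ↔ b)`; then for every `a`,
`μ_{glue_C w}(v ↔ b ∩ (q ↔ b)ᶜ ∩ a ↔ q) ≤ μ_{glue_C w}(q ↔ b ∩ (v ↔ b)ᶜ ∩ (a ↔ v)ᶜ)`.
[cite: KozmaNitzan2024, Lemma 3(i) and Lemma 5 (pp. 6, 13); VandenbergHaggstromKahn2005, Thm. 1.2] -/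
theorem threeRelayExchange (w : Sym2 (Fin n) → unitInterval) (C : Finset (Fin n)) (v q a b : Fin n)
    (hqC : q ∈ C)
    (hyp : (prodBernoulli w).real (openConn v b) ≤ (prodBernoulli w).real (openConn q b)) :
    (prodBernoulli (fun e : Sym2 (Fin n) => if (∀ x ∈ e, x ∈ C) ∧ ¬ e.IsDiag then 1 else w e)).real
        (openConn v b ∩ (openConn q b)ᶜ ∩ openConn a q) ≤
      (prodBernoulli (fun e : Sym2 (Fin n) => if (∀ x ∈ e, x ∈ C) ∧ ¬ e.IsDiag then 1 else w e)).real
        (openConn q b ∩ (openConn v b)ᶜ ∩ (openConn a v)ᶜ) := by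
  set g : Sym2 (Fin n) → unitInterval := fun e => if (∀ x ∈ e, x ∈ C) ∧ ¬ e.IsDiag then 1 else w e with hg
  -- the event `{q ↔ a}` is increasing in the open edge cluster of `q`, jointly with `C` internally open
  set E : Set (BondConfig (Fin n)) := openConn q a with hEdef
  have hE : ∀ ω ω' : BondConfig (Fin n), ω ∈ E →
      (∀ e : Sym2 (Fin n), (∀ x ∈ e, x ∈ C) → ¬ e.IsDiag → e ∈ ω) →
      openEdgeCluster ω q ⊆ openEdgeCluster ω' q →
      ω' ∈ E ∧ ∀ e : Sym2 (Fin n), (∀ x ∈ e, x ∈ C) → ¬ e.IsDiag → e ∈ ω' := by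
    intro ω ω' hω hF hsub
    have key := mem_openEdgeCluster_of_open_mem C q hqC ω hF
    refine ⟨?_, fun e heS hed => ?_⟩
    · have hqa : (openGraph ω).Reachable q a := hω
      have hqa' : (openGraph ω').Reachable q a := by
        rw [reachable_iff_exists_mem_openEdgeCluster] at hqa ⊢
        rcases hqa with h | ⟨e, he, hae⟩
        · exact Or.inl h
        · exact Or.inr ⟨e, hsub he, hae⟩
      exact hqa'
    · have heω : e ∈ ω := hF e heS hed
      have hSne : ∃ x ∈ e, x ∈ C := by
        induction e using Sym2.ind with
        | h x y => exact ⟨x, Sym2.mem_mk_left x y, heS x (Sym2.mem_mk_left x y)⟩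
      exact openEdgeCluster_subset ω' q (hsub (key.2 e heω hed hSne))
  have hx := upsetExchange_event w C v b q E hE hyp
  -- remove the common part `{v ↔ b} ∩ {q ↔ b} ∩ {q ↔ a}` from both sides
  set Z : Set (BondConfig (Fin n)) := openConn v b ∩ openConn q b ∩ E with hZ
  have hL : (prodBernoulli g).real (openConn v b ∩ (openConn q b)ᶜ ∩ openConn a q) =
      (prodBernoulli g).real (openConn v b ∩ E) - (prodBernoulli g).real Z := by
    have hsplit := measureReal_inter_add_sdiff (μ := prodBernoulli g) (s := openConn v b ∩ E)
      (MeasurableSet.of_discrete : MeasurableSet (openConn q b : Set (BondConfig (Fin n)))) (measure_ne_top _ _)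
    have h1 : openConn v b ∩ E ∩ openConn q b = Z := by
      rw [hZ]; ext ω; simp only [mem_inter_iff]; tauto
    have h2 : (openConn v b ∩ E) \ openConn q b = openConn v b ∩ (openConn q b)ᶜ ∩ openConn a q := by
      ext ω
      simp only [hEdef, mem_sdiff, mem_inter_iff, mem_compl_iff]
      constructor
      · rintro ⟨⟨hvb, hqa⟩, hqb⟩
        exact ⟨⟨hvb, hqb⟩, (hqa : (openGraph ω).Reachable q a).symm⟩
      · rintro ⟨⟨hvb, hqb⟩, haq⟩
        exact ⟨⟨hvb, (haq : (openGraph ω).Reachable a q).symm⟩, hqb⟩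
    rw [h1, h2] at hsplit
    linarith
  have hR : (prodBernoulli g).real (openConn q b ∩ E) - (prodBernoulli g).real Z ≤
      (prodBernoulli g).real (openConn q b ∩ (openConn v b)ᶜ ∩ (openConn a v)ᶜ) := by
    have hsplit := measureReal_inter_add_sdiff (μ := prodBernoulli g) (s := openConn q b ∩ E)
      (MeasurableSet.of_discrete : MeasurableSet (openConn v b : Set (BondConfig (Fin n)))) (measure_ne_top _ _)
    have h1 : openConn q b ∩ E ∩ openConn v b = Z := by
      rw [hZ]; ext ω; simp only [mem_inter_iff]; tauto
    have h2 : (prodBernoulli g).real ((openConn q b ∩ E) \ openConn v b) ≤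
        (prodBernoulli g).real (openConn q b ∩ (openConn v b)ᶜ ∩ (openConn a v)ᶜ) := by
      refine measureReal_mono ?_ (measure_ne_top _ _)
      rintro ω ⟨⟨hqb, hqa⟩, hvb⟩
      refine ⟨⟨hqb, hvb⟩, fun hav => hvb ?_⟩
      -- `a ↔ v` together with `q ↔ a`, `q ↔ b` gives `v ↔ b`
      have hqa' : (openGraph ω).Reachable q a := hqa
      have hav' : (openGraph ω).Reachable a v := hav
      have hqb' : (openGraph ω).Reachable q b := hqb
      exact (hav'.symm.trans hqa'.symm).trans hqb'
    rw [h1] at hsplit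
    linarith
  calc (prodBernoulli g).real (openConn v b ∩ (openConn q b)ᶜ ∩ openConn a q)
      = (prodBernoulli g).real (openConn v b ∩ E) - (prodBernoulli g).real Z := hL
    _ ≤ (prodBernoulli g).real (openConn q b ∩ E) - (prodBernoulli g).real Z := by linarith
    _ ≤ (prodBernoulli g).real (openConn q b ∩ (openConn v b)ᶜ ∩ (openConn a v)ᶜ) := hR

end UpsetExchange

end

end Summit.CriticalPhenomena.PercolationContinuityZ3.Theorems
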